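import Summits.QuantumFields.BalabanUV.Beta.GAN24.SymFaceDataVHNull
import Summits.QuantumFields.BalabanUV.Beta.GAN24.TransportedMixedLegCurrents
import Summits.QuantumFields.BalabanUV.Beta.GAN24.CombExitFaceCurrentDivFree
import Summits.QuantumFields.BalabanUV.Beta.GAN24.CombWWordZero
import Summits.QuantumFields.BalabanUV.Beta.GAN24.CombForcingSectorSplit
import Summits.QuantumFields.BalabanUV.Beta.GAN24.FaceWordNullSector
import Summits.QuantumFields.BalabanUV.Beta.GAN24.ExitFaceCurrentDivFree
import Summits.QuantumFields.BalabanUV.Beta.GAN24.StencilSlotOfShapes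
import Summits.QuantumFields.BalabanUV.Beta.GAN24.FaceWordVHNullCurrents

/-!
# `BalabanUV.Beta.GAN24.CombFaceWordSockets` — binder row G-an2-4 ∕ (CONV-C), TRANSFER-III, the (III′) (C)-row's `hXF (l+1)` FACE TERMS (OWNER gan24-p1 g53's memo
# `M3-HXF-SIZING-g53.md` §1): **THE SOCKETS OF leaf-06's `faceWord_eq_cellPairing_of_null` AT THE COMB DATA** — (i) the transported symmetrised border `𝒯(unitS (c′ • symVhSAt ρ_c))`
# has NULL two-face currents at every period `Lc·N`, both leg orders, every free leg (my A `SymFaceDataVHNull` carried through `𝒯` by my D1 `TransportedMixedLegCurrents` §3);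
# (ii) a transported table without multiplier legs has none; (iii) the two-face currents of the TRANSPORTED cubic sector `𝒯(unitS (c₀ • e3OfK Lc G_j M))` ARE those of the untransported
# one — free first leg by g87 L `exitRow_current_transport_eq_of_divFree` under the (D) letter, free second leg through the leg antisymmetry (g86 C `sector_antisymm`, A1 `unitS_antisymm`,
# D1 `transport_antisymm`); (iv) the (D) letter itself at period `Lc·N` for the comb E-sector at an1's record: g87 K `divFree_e3OfK_transport_ScombOf` with the class datum `(Lc·N)⁻¹ + dΦ`
# (leaf-04's `face_eq_class` at the period `Lc·N`).  Consumer: `CombFaceWordCellPairing`.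
# (G-an2-4 CRUX TEAM (2), leaf prover `b2b-balaban-gan24-formalise-leaf-01`, gen 88; journal [LEAF01-G88-INTENT-4])

NOT IN PRINT; OUR BOOKKEEPING ([folklore] BY NAME; 0 `def`, 0 cited fact, 0 `def … : Prop`, 0 sorry).
HONEST FRAMING (cell contract, verbatim): «discharging `BetaPertH` makes Bałaban's UV stability UNCONDITIONAL — a real constructive-QFT result; it is NOT the continuum limit and NOT the
Clay problem.»  HONEST DEPENDENCY (verbatim): «continuum YM on T⁴ ⇐ BetaPertH ∧ nine spine estimates (0/9 proved); BetaPertH ⇐ (D1) ∧ (D4) ∧ CAP+tail; G-an2-4 gates asym, D1 and NE2/3/4.»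
WHAT ([folklore]; `[NeZero Lc]`): §1 `unitS_smul_entry`, `unitS_symm_member`, `exitInd_bdd_supp`, `transport_noMul`, **`transport_symVhS_null`**; §2 **`faceCurrent_transport_sector_eq`** (free first leg),
**`faceCurrent_transport_sector_eq_fst`** (free second leg); §3 **`divFree_sector_comb`**.  Asserts NO value of Bałaban's tables; NEVER «G-an2-4 closed» as (CONV-C); NOT D1, NOT `BetaPertH`,
NOT continuum, NOT Clay.  2026-08-27; no existing file touched.
-/

noncomputable section

open Finset
open scoped BigOperators
open Literature.MathematicalPhysics.QuantumFieldTheory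
open Literature.MathematicalPhysics.QuantumFieldTheory.Balaban1983to89
open Literature.MathematicalPhysics.QuantumFieldTheory.Balaban1983to89.Beta
open ExpKernelCalculus (Site MKer Decays comp shiftK)
open OneStepResolventKernel (Fib LocStencil)
open OneStepKernelFamily (KInvStep shiftK_KInvStep)
open AffineAveraging (box toSite unitVec)
open AveragingContoursRooted (ctr ctrOff ctrOff_mem_box)
open StepJetData (wilsonA wilsonA_antisymm locStencil_wilsonA locStencil_smul)
open BalabanStepJetsSucc (wE wVH)
open Summit.QuantumFields.BalabanUV.Beta.TameKernelCalculus (trK)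
open Summit.QuantumFields.BalabanUV.Beta.BorderedHessian (sgnK)
open Summit.QuantumFields.BalabanUV.Beta.AxialDressingRooted (coDressKBmAt decays_coDressKBmAt_KInvStep shiftK_coDressKBmAt one_le_of_neZero)
open Summit.QuantumFields.BalabanUV.Beta.HessKerDressedUnits (unitK unitS unitS_apply locStencil_unitS decays_unitK)
open Summit.QuantumFields.BalabanUV.Beta.SpineRooted (e3OfK)
open Summit.QuantumFields.BalabanUV.Beta.SymAveragingHessianCounts (symVhSAt symVhSAt_symm)
open Summit.QuantumFields.BalabanUV.Beta.SymSecondOrderTablesAn1 (symTablesAn1S2)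
open Summit.QuantumFields.BalabanUV.Beta.CombChartStepJets (ScombOf SpureCombOf)
open Summit.QuantumFields.BalabanUV.Beta.SymCorrectorKernel (psiKS)
open Summit.QuantumFields.BalabanUV.Beta.SymCorrectorFace (slotPsiS b6unitVec_eq)
open Summit.QuantumFields.BalabanUV.Beta.SymCorrectorSlot (comp_psiKS_inr_right comp_trK_psiKS_inr_left)
open Summit.QuantumFields.BalabanUV.Beta.GAN24.CombCubicStepTransport (locStencil_transportPsiS)
open Summit.QuantumFields.BalabanUV.Beta.GAN24.CombForcingTwoFaceWords (exists_locStencil_transport_S)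
open Summit.QuantumFields.BalabanUV.Beta.GAN24.CombTransportedBorder (transport_unitS slotPsiS_entry_eq_zero locStencil_symVhS)
open Summit.QuantumFields.BalabanUV.Beta.GAN24.CombWWordZero (transportS_unitS_translate)
open Summit.QuantumFields.BalabanUV.Beta.GAN24.CombForcingSectorSplit (transport_SpureCombOf_succ transport_SpureCombOf_zero)
open Summit.QuantumFields.BalabanUV.Beta.GAN24.CombVHEWordsZeroStep (sector_inr_left sector_inr_right sector_antisymm exists_locStencil_sector exists_locStencil_transport_ScombOf
  parityOdd_transport_ScombOf)
open Summit.QuantumFields.BalabanUV.Beta.GAN24.CombExitFaceCurrentDivFree (divFree_e3OfK_transport_ScombOf)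
open Summit.QuantumFields.BalabanUV.Beta.GAN24.ExitFaceCurrentDivFree (face_eq_class abs_facePot_le unitS_smul_inl_inl)
open Summit.QuantumFields.BalabanUV.Beta.GAN24.WilsonCurrentBoxForm (divFree_wilson_current)
open Summit.QuantumFields.BalabanUV.Beta.GAN24.StencilSlotOfShapes (unitS_add)
open Summit.QuantumFields.BalabanUV.Beta.GAN24.FaceWordVHNullCurrents (emod_face_of_dvd)
open Summit.QuantumFields.BalabanUV.Beta.GAN24.FaceWordNullSector (faceWord_eq_cellPairing_of_null)
open Summit.QuantumFields.BalabanUV.Beta.GAN24.ExitFaceWeightTransport (exitRow_current_transport_eq_of_divFree)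
open Summit.QuantumFields.BalabanUV.Beta.GAN24.TransportedWordTools (unitS_antisymm)
open Summit.QuantumFields.BalabanUV.Beta.GAN24.TransportedMixedLegCurrents (transport_antisymm exitRow_current_transport_eq_zero_fst exitRow_current_transport_eq_zero_snd)
open Summit.QuantumFields.BalabanUV.Beta.GAN24.SymFaceDataVHNull (symVhSAt_faceData_eq_zero')

namespace Summit.QuantumFields.BalabanUV.Beta.GAN24.CombFaceWordSockets

variable {d : ℕ} {Lc : ℕ} [NeZero Lc]

/-! ## §1 Sockets -/

omit [NeZero Lc] in
/-- [folklore] Units and a scalar on any entry of a table family are a leg-type constant factor. -/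
theorem unitS_smul_entry (sf sm c : ℝ) (V : Fin (d + 1) → Site (d + 1) → MKer (d + 1) (Fib d)) (κ : Fin (d + 1)) (u x z : Site (d + 1)) (a b : Fib d) :
    unitS sf sm (fun κ u => c • V κ u) κ u x z a b
      = ((sf * sm)⁻¹ * HessKerDressedUnits.legScale sf⁻¹ sm⁻¹ a * c * HessKerDressedUnits.legScale sf⁻¹ sm⁻¹ b) * V κ u x z a b := by
  rw [unitS_apply]
  simp only [Pi.smul_apply, smul_eq_mul]
  ring

omit [NeZero Lc] in
/-- [folklore] Units preserve the leg symmetry of a table. -/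
theorem unitS_symm_member (sf sm : ℝ) {S : Fin (d + 1) → Site (d + 1) → MKer (d + 1) (Fib d)}
    (hS : ∀ (κ : Fin (d + 1)) (u x z : Site (d + 1)) (a b : Fib d), S κ u z x b a = S κ u x z a b)
    (κ : Fin (d + 1)) (u x z : Site (d + 1)) (a b : Fib d) : unitS sf sm S κ u z x b a = unitS sf sm S κ u x z a b := by
  rw [unitS_apply, unitS_apply, hS κ u x z a b]
  ring

omit [NeZero Lc] in
/-- [folklore] The period-`Lc·N` exit indicator is bounded by `1` and exit-row supported (mod `Lc`). -/
theorem exitInd_bdd_supp (hLc : 1 ≤ Lc) (N : ℕ) :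
    (∀ k : ℤ, |(fun k : ℤ => if k % ((Lc * N : ℕ) : ℤ) = ((Lc * N : ℕ) : ℤ) - 1 then (1 : ℝ) else 0) k| ≤ 1) ∧
      (∀ k : ℤ, (fun k : ℤ => if k % ((Lc * N : ℕ) : ℤ) = ((Lc * N : ℕ) : ℤ) - 1 then (1 : ℝ) else 0) k ≠ 0 → k % (Lc : ℤ) = (Lc : ℤ) - 1) := by
  refine ⟨fun k => ?_, fun k hk => ?_⟩
  · beta_reduce
    split_ifs <;> simp
  · beta_reduce at hk
    by_cases h : k % ((Lc * N : ℕ) : ℤ) = ((Lc * N : ℕ) : ℤ) - 1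
    · exact emod_face_of_dvd hLc h
    · exact absurd (if_neg h) hk

omit [NeZero Lc] in
/-- [folklore] **THE TRANSPORT OF A TABLE WITHOUT MULTIPLIER LEGS HAS NO MULTIPLIER LEGS** (`Ψ̂_S`'s multiplier block is the identity, its mixed blocks vanish; the slot transport is a
combination of members at the same legs). -/
theorem transport_noMul {S : Fin (d + 1) → Site (d + 1) → MKer (d + 1) (Fib d)}
    (hl : ∀ (κ : Fin (d + 1)) (t y x : Site (d + 1)) (m : Fin (d + 1)) (b : Fib d), S κ t y x (Sum.inr m) b = 0)
    (hr' : ∀ (κ : Fin (d + 1)) (t y x : Site (d + 1)) (a : Fib d) (m : Fin (d + 1)), S κ t y x a (Sum.inr m) = 0)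
    (κ : Fin (d + 1)) (t y x : Site (d + 1)) (m : Fin (d + 1)) (b : Fib d) :
    comp (comp (trK (psiKS (ctrOff (d + 1) Lc) Lc)) (slotPsiS (ctrOff (d + 1) Lc) Lc S κ t)) (psiKS (ctrOff (d + 1) Lc) Lc) y x (Sum.inr m) b = 0 ∧
      comp (comp (trK (psiKS (ctrOff (d + 1) Lc) Lc)) (slotPsiS (ctrOff (d + 1) Lc) Lc S κ t)) (psiKS (ctrOff (d + 1) Lc) Lc) y x b (Sum.inr m) = 0 := by
  constructor
  · show (∑' w, ∑ e, comp (trK (psiKS (ctrOff (d + 1) Lc) Lc)) (slotPsiS (ctrOff (d + 1) Lc) Lc S κ t) y w (Sum.inr m) e * psiKS (ctrOff (d + 1) Lc) Lc w x e b) = 0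
    refine (tsum_congr fun w => ?_).trans tsum_zero
    refine Finset.sum_eq_zero fun e _ => ?_
    rw [comp_trK_psiKS_inr_left, slotPsiS_entry_eq_zero (ctrOff (d + 1) Lc) (fun κ u => hl κ u y w m e), zero_mul]
  · rw [comp_psiKS_inr_right]
    show (∑' w, ∑ e, trK (psiKS (ctrOff (d + 1) Lc) Lc) y w b e * slotPsiS (ctrOff (d + 1) Lc) Lc S κ t w x e (Sum.inr m)) = 0
    refine (tsum_congr fun w => ?_).trans tsum_zero
    refine Finset.sum_eq_zero fun e _ => ?_
    rw [slotPsiS_entry_eq_zero (ctrOff (d + 1) Lc) (fun κ u => hr' κ u w x e m), mul_zero]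

/-- NOT IN PRINT; OUR BOOKKEEPING ([folklore]).  **THE TRANSPORTED SYMMETRISED BORDER HAS NULL TWO-FACE CURRENTS AT EVERY PERIOD `Lc·N`, BOTH LEG ORDERS, EVERY FREE LEG** — my A
`symVhSAt_faceData_eq_zero'` for `unitS (c′ • symVhSAt ρ_c d Lc)` (the units are a constant factor), carried through `𝒯` by my D1 §3 (the border is leg-symmetric). -/
theorem transport_symVhS_null (sf sm c' : ℝ) (N : ℕ) (μ α : Fin (d + 1)) :
    (∀ (x : Site (d + 1)) (f : Fib d), (∑' y : Site (d + 1), (if y α % ((Lc * N : ℕ) : ℤ) = ((Lc * N : ℕ) : ℤ) - 1 then (1 : ℝ) else 0) *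
        ∑' t : Site (d + 1), (if t μ % ((Lc * N : ℕ) : ℤ) = ((Lc * N : ℕ) : ℤ) - 1 then
          (fun κ u => comp (comp (trK (psiKS (ctrOff (d + 1) Lc) Lc)) (slotPsiS (ctrOff (d + 1) Lc) Lc (unitS sf sm (fun κ u => c' • symVhSAt (ctr (d + 1) Lc) d Lc rfl κ u)) κ u))
            (psiKS (ctrOff (d + 1) Lc) Lc)) μ t y x (Sum.inl α) f else 0)) = 0) ∧
    (∀ (z : Site (d + 1)) (g : Fib d), (∑' w : Site (d + 1), (if w α % ((Lc * N : ℕ) : ℤ) = ((Lc * N : ℕ) : ℤ) - 1 then (1 : ℝ) else 0) *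
        ∑' t : Site (d + 1), (if t μ % ((Lc * N : ℕ) : ℤ) = ((Lc * N : ℕ) : ℤ) - 1 then
          (fun κ u => comp (comp (trK (psiKS (ctrOff (d + 1) Lc) Lc)) (slotPsiS (ctrOff (d + 1) Lc) Lc (unitS sf sm (fun κ u => c' • symVhSAt (ctr (d + 1) Lc) d Lc rfl κ u)) κ u))
            (psiKS (ctrOff (d + 1) Lc) Lc)) μ t z w g (Sum.inl α) else 0)) = 0) := by
  have hLc1 : 1 ≤ Lc := one_le_of_neZero Lc
  have hLc : 0 < Lc := hLc1
  have hr : ctrOff (d + 1) Lc ∈ box (d + 1) Lc := ctrOff_mem_box hLc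
  obtain ⟨hχb, hχs⟩ := exitInd_bdd_supp hLc1 N
  have hV : LocStencil (unitS sf sm (fun κ u => c' • symVhSAt (ctr (d + 1) Lc) d Lc rfl κ u)) _ 1 := locStencil_unitS (locStencil_symVhS (Lc := Lc) c' zero_le_one)
  have hsym : ∀ (κ : Fin (d + 1)) (u x z : Site (d + 1)) (a b : Fib d), unitS sf sm (fun κ u => c' • symVhSAt (ctr (d + 1) Lc) d Lc rfl κ u) κ u z x b a
      = unitS sf sm (fun κ u => c' • symVhSAt (ctr (d + 1) Lc) d Lc rfl κ u) κ u x z a b :=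
    unitS_symm_member sf sm (fun κ u x z a b => by
      show ((c' : ℝ) • symVhSAt (ctr (d + 1) Lc) d Lc rfl κ u) z x b a = (c' • symVhSAt (ctr (d + 1) Lc) d Lc rfl κ u) x z a b
      simp only [Pi.smul_apply, smul_eq_mul, symVhSAt_symm (ctr (d + 1) Lc) Lc κ u x z a b])
  -- the untransported null (A), every free leg, free leg first
  have hnull : ∀ (a : Fib d) (v : Site (d + 1)), ∑' q : Site (d + 1), (if q α % ((Lc * N : ℕ) : ℤ) = ((Lc * N : ℕ) : ℤ) - 1 then (1 : ℝ) else 0) *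
      ∑' u : Site (d + 1), (if u μ % ((Lc * N : ℕ) : ℤ) = ((Lc * N : ℕ) : ℤ) - 1 then (1 : ℝ) else 0) *
        unitS sf sm (fun κ u => c' • symVhSAt (ctr (d + 1) Lc) d Lc rfl κ u) μ u v q a (Sum.inl α) = 0 := by
    intro a v
    have hin : ∀ q : Site (d + 1), (∑' u : Site (d + 1), (if u μ % ((Lc * N : ℕ) : ℤ) = ((Lc * N : ℕ) : ℤ) - 1 then (1 : ℝ) else 0) *
        unitS sf sm (fun κ u => c' • symVhSAt (ctr (d + 1) Lc) d Lc rfl κ u) μ u v q a (Sum.inl α)) =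
        ((sf * sm)⁻¹ * HessKerDressedUnits.legScale sf⁻¹ sm⁻¹ a * c' * HessKerDressedUnits.legScale sf⁻¹ sm⁻¹ (Sum.inl α)) *
          ∑' u : Site (d + 1), (if u μ % ((Lc * N : ℕ) : ℤ) = ((Lc * N : ℕ) : ℤ) - 1 then (1 : ℝ) else 0) * symVhSAt (ctr (d + 1) Lc) d Lc rfl μ u v q a (Sum.inl α) := by
      intro q
      rw [← tsum_mul_left]
      refine tsum_congr fun u => ?_
      rw [unitS_smul_entry]
      ring
    simp_rw [hin]
    rw [show (∑' q : Site (d + 1), (if q α % ((Lc * N : ℕ) : ℤ) = ((Lc * N : ℕ) : ℤ) - 1 then (1 : ℝ) else 0) *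
        (((sf * sm)⁻¹ * HessKerDressedUnits.legScale sf⁻¹ sm⁻¹ a * c' * HessKerDressedUnits.legScale sf⁻¹ sm⁻¹ (Sum.inl α)) *
          ∑' u : Site (d + 1), (if u μ % ((Lc * N : ℕ) : ℤ) = ((Lc * N : ℕ) : ℤ) - 1 then (1 : ℝ) else 0) * symVhSAt (ctr (d + 1) Lc) d Lc rfl μ u v q a (Sum.inl α))) =
        ((sf * sm)⁻¹ * HessKerDressedUnits.legScale sf⁻¹ sm⁻¹ a * c' * HessKerDressedUnits.legScale sf⁻¹ sm⁻¹ (Sum.inl α)) *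
          ∑' q : Site (d + 1), (if q α % ((Lc * N : ℕ) : ℤ) = ((Lc * N : ℕ) : ℤ) - 1 then (1 : ℝ) else 0) *
            ∑' u : Site (d + 1), (if u μ % ((Lc * N : ℕ) : ℤ) = ((Lc * N : ℕ) : ℤ) - 1 then (1 : ℝ) else 0) * symVhSAt (ctr (d + 1) Lc) d Lc rfl μ u v q a (Sum.inl α) by
      rw [← tsum_mul_left]; exact tsum_congr fun q => by ring]
    have h0 := symVhSAt_faceData_eq_zero' (d := d) hLc1 hr μ α (h := fun k : ℤ => if k % ((Lc * N : ℕ) : ℤ) = ((Lc * N : ℕ) : ℤ) - 1 then (1 : ℝ) else 0)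
      (s := fun k : ℤ => if k % ((Lc * N : ℕ) : ℤ) = ((Lc * N : ℕ) : ℤ) - 1 then (1 : ℝ) else 0)
      (fun n hn => by by_contra hne; exact hn (hχs n hne)) (fun n hn => by by_contra hne; exact hn (hχs n hne)) v a
    rw [show (ctr (d + 1) Lc : Site (d + 1)) = toSite (ctrOff (d + 1) Lc) from rfl, h0, mul_zero]
  refine ⟨fun x f => ?_, fun z g => ?_⟩
  · exact (tsum_congr fun y => by congr 1; exact tsum_congr fun t => by split_ifs <;> simp).trans
      (exitRow_current_transport_eq_zero_snd hLc hr hV one_pos hsym hχb hχb hχs hχs μ α hnull f x)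
  · exact (tsum_congr fun w => by congr 1; exact tsum_congr fun t => by split_ifs <;> simp).trans
      (exitRow_current_transport_eq_zero_fst hLc hr hV one_pos hχb hχb hχs hχs μ α hnull g z)

/-! ## §2 The two-face currents of the transported E-sector are those of the E-sector -/

section Sector

variable {M : Fin (d + 1) → Site (d + 1) → MKer (d + 1) (Fib d)} {CM δM : ℝ}

/-- NOT IN PRINT; OUR BOOKKEEPING ([folklore]).  **FREE FIRST LEG**: for the cubic sector `T = unitS (c₀ • e3OfK Lc G_j M)` of a local parity-odd member `M` whose exit-face currents of
period `Lc·N` are first-leg DIVERGENCE-FREE (`hdiv`, the (D) letter in g87 L's currency), `Σ'_w χ(w_β)·Σ'_t [t_ν face]·(𝒯T ν t) z w (inl b)(inl β) = Σ'_w χ(w_β)·Σ'_t [t_ν face]·T ν t z w (inl b)(inl β)`. -/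
theorem faceCurrent_transport_sector_eq (sf sm c₀ : ℝ) (j N : ℕ) (hM : LocStencil M CM δM) (hδM : 0 < δM) (ν β : Fin (d + 1))
    (hdiv : ∀ x : Site (d + 1), ∑ κ : Fin (d + 1),
      ((∑' q : Site (d + 1), (if q β % ((Lc * N : ℕ) : ℤ) = ((Lc * N : ℕ) : ℤ) - 1 then (1 : ℝ) else 0) *
          ∑' u : Site (d + 1), (if u ν % ((Lc * N : ℕ) : ℤ) = ((Lc * N : ℕ) : ℤ) - 1 then (1 : ℝ) else 0) *
            unitS sf sm (fun κ t => c₀ • e3OfK Lc (coDressKBmAt (toSite (ctrOff (d + 1) Lc)) Lc (KInvStep (d := d) Lc j)) M κ t) ν u (x - unitVec κ) q (Sum.inl κ) (Sum.inl β))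
        - ∑' q : Site (d + 1), (if q β % ((Lc * N : ℕ) : ℤ) = ((Lc * N : ℕ) : ℤ) - 1 then (1 : ℝ) else 0) *
          ∑' u : Site (d + 1), (if u ν % ((Lc * N : ℕ) : ℤ) = ((Lc * N : ℕ) : ℤ) - 1 then (1 : ℝ) else 0) *
            unitS sf sm (fun κ t => c₀ • e3OfK Lc (coDressKBmAt (toSite (ctrOff (d + 1) Lc)) Lc (KInvStep (d := d) Lc j)) M κ t) ν u x q (Sum.inl κ) (Sum.inl β)) = 0)
    (b : Fin (d + 1)) (z : Site (d + 1)) :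
    (∑' w : Site (d + 1), (if w β % ((Lc * N : ℕ) : ℤ) = ((Lc * N : ℕ) : ℤ) - 1 then (1 : ℝ) else 0) *
        ∑' t : Site (d + 1), (if t ν % ((Lc * N : ℕ) : ℤ) = ((Lc * N : ℕ) : ℤ) - 1 then
          (fun κ u => comp (comp (trK (psiKS (ctrOff (d + 1) Lc) Lc)) (slotPsiS (ctrOff (d + 1) Lc) Lc
            (unitS sf sm (fun κ t => c₀ • e3OfK Lc (coDressKBmAt (toSite (ctrOff (d + 1) Lc)) Lc (KInvStep (d := d) Lc j)) M κ t)) κ u)) (psiKS (ctrOff (d + 1) Lc) Lc)) ν t z w (Sum.inl b) (Sum.inl β)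
          else 0)) =
      ∑' w : Site (d + 1), (if w β % ((Lc * N : ℕ) : ℤ) = ((Lc * N : ℕ) : ℤ) - 1 then (1 : ℝ) else 0) *
        ∑' t : Site (d + 1), (if t ν % ((Lc * N : ℕ) : ℤ) = ((Lc * N : ℕ) : ℤ) - 1 then
          unitS sf sm (fun κ t => c₀ • e3OfK Lc (coDressKBmAt (toSite (ctrOff (d + 1) Lc)) Lc (KInvStep (d := d) Lc j)) M κ t) ν t z w (Sum.inl b) (Sum.inl β) else 0) := by
  have hLc1 : 1 ≤ Lc := one_le_of_neZero Lc
  have hLc : 0 < Lc := hLc1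
  have hr : ctrOff (d + 1) Lc ∈ box (d + 1) Lc := ctrOff_mem_box hLc
  obtain ⟨hχb, hχs⟩ := exitInd_bdd_supp hLc1 N
  obtain ⟨CE, δE, hδE, hE⟩ := exists_locStencil_sector hr c₀ j hM hδM
  have hEu := locStencil_unitS (sf := sf) (sm := sm) hE
  exact (tsum_congr fun w => by congr 1; exact tsum_congr fun t => by split_ifs <;> simp).trans
    ((exitRow_current_transport_eq_of_divFree hLc hr hEu hδE hχb hχb hχs hχs ν β hdiv b z).trans
      (tsum_congr fun w => by congr 1; exact tsum_congr fun t => by split_ifs <;> simp))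

/-- NOT IN PRINT; OUR BOOKKEEPING ([folklore]).  **FREE SECOND LEG** (the weight on the first leg): the same, through the leg antisymmetry of the cubic sector (g86 C `sector_antisymm`, A1
`unitS_antisymm`) and of its transport (D1 `transport_antisymm`) — `hdiv` is asked for the slot `μ` and leg `α`. -/
theorem faceCurrent_transport_sector_eq_fst (sf sm c₀ : ℝ) (j N : ℕ) (hM : LocStencil M CM δM) (hδM : 0 < δM) (hMp : ∀ κ u, trK (M κ u) = -sgnK (M κ u))
    (μ α : Fin (d + 1))
    (hdiv : ∀ x : Site (d + 1), ∑ κ : Fin (d + 1),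
      ((∑' q : Site (d + 1), (if q α % ((Lc * N : ℕ) : ℤ) = ((Lc * N : ℕ) : ℤ) - 1 then (1 : ℝ) else 0) *
          ∑' u : Site (d + 1), (if u μ % ((Lc * N : ℕ) : ℤ) = ((Lc * N : ℕ) : ℤ) - 1 then (1 : ℝ) else 0) *
            unitS sf sm (fun κ t => c₀ • e3OfK Lc (coDressKBmAt (toSite (ctrOff (d + 1) Lc)) Lc (KInvStep (d := d) Lc j)) M κ t) μ u (x - unitVec κ) q (Sum.inl κ) (Sum.inl α))
        - ∑' q : Site (d + 1), (if q α % ((Lc * N : ℕ) : ℤ) = ((Lc * N : ℕ) : ℤ) - 1 then (1 : ℝ) else 0) *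
          ∑' u : Site (d + 1), (if u μ % ((Lc * N : ℕ) : ℤ) = ((Lc * N : ℕ) : ℤ) - 1 then (1 : ℝ) else 0) *
            unitS sf sm (fun κ t => c₀ • e3OfK Lc (coDressKBmAt (toSite (ctrOff (d + 1) Lc)) Lc (KInvStep (d := d) Lc j)) M κ t) μ u x q (Sum.inl κ) (Sum.inl α)) = 0)
    (a : Fin (d + 1)) (x : Site (d + 1)) :
    (∑' y : Site (d + 1), (if y α % ((Lc * N : ℕ) : ℤ) = ((Lc * N : ℕ) : ℤ) - 1 then (1 : ℝ) else 0) *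
        ∑' t : Site (d + 1), (if t μ % ((Lc * N : ℕ) : ℤ) = ((Lc * N : ℕ) : ℤ) - 1 then
          (fun κ u => comp (comp (trK (psiKS (ctrOff (d + 1) Lc) Lc)) (slotPsiS (ctrOff (d + 1) Lc) Lc
            (unitS sf sm (fun κ t => c₀ • e3OfK Lc (coDressKBmAt (toSite (ctrOff (d + 1) Lc)) Lc (KInvStep (d := d) Lc j)) M κ t)) κ u)) (psiKS (ctrOff (d + 1) Lc) Lc)) μ t y x (Sum.inl α) (Sum.inl a)
          else 0)) =
      ∑' y : Site (d + 1), (if y α % ((Lc * N : ℕ) : ℤ) = ((Lc * N : ℕ) : ℤ) - 1 then (1 : ℝ) else 0) *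
        ∑' t : Site (d + 1), (if t μ % ((Lc * N : ℕ) : ℤ) = ((Lc * N : ℕ) : ℤ) - 1 then
          unitS sf sm (fun κ t => c₀ • e3OfK Lc (coDressKBmAt (toSite (ctrOff (d + 1) Lc)) Lc (KInvStep (d := d) Lc j)) M κ t) μ t y x (Sum.inl α) (Sum.inl a) else 0) := by
  have hLc1 : 1 ≤ Lc := one_le_of_neZero Lc
  have hLc : 0 < Lc := hLc1
  have hr : ctrOff (d + 1) Lc ∈ box (d + 1) Lc := ctrOff_mem_box hLc
  obtain ⟨CE, δE, hδE, hE⟩ := exists_locStencil_sector hr c₀ j hM hδM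
  have hEu := locStencil_unitS (sf := sf) (sm := sm) hE
  have hanti := unitS_antisymm sf sm (sector_antisymm hr c₀ j hM hδM hMp)
  have hantiT := fun (t y : Site (d + 1)) => transport_antisymm hLc hr hEu hδE hanti μ t x y (Sum.inl a) (Sum.inl α)
  -- flip both legs on both sides, then the free-first-leg form
  have eL : ∀ y : Site (d + 1), (∑' t : Site (d + 1), (if t μ % ((Lc * N : ℕ) : ℤ) = ((Lc * N : ℕ) : ℤ) - 1 then
          (fun κ u => comp (comp (trK (psiKS (ctrOff (d + 1) Lc) Lc)) (slotPsiS (ctrOff (d + 1) Lc) Lc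
            (unitS sf sm (fun κ t => c₀ • e3OfK Lc (coDressKBmAt (toSite (ctrOff (d + 1) Lc)) Lc (KInvStep (d := d) Lc j)) M κ t)) κ u)) (psiKS (ctrOff (d + 1) Lc) Lc)) μ t y x (Sum.inl α) (Sum.inl a)
          else 0)) =
      -(∑' t : Site (d + 1), (if t μ % ((Lc * N : ℕ) : ℤ) = ((Lc * N : ℕ) : ℤ) - 1 then
          (fun κ u => comp (comp (trK (psiKS (ctrOff (d + 1) Lc) Lc)) (slotPsiS (ctrOff (d + 1) Lc) Lc
            (unitS sf sm (fun κ t => c₀ • e3OfK Lc (coDressKBmAt (toSite (ctrOff (d + 1) Lc)) Lc (KInvStep (d := d) Lc j)) M κ t)) κ u)) (psiKS (ctrOff (d + 1) Lc) Lc)) μ t x y (Sum.inl a) (Sum.inl α)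
          else 0)) := by
    intro y
    rw [← tsum_neg]
    refine tsum_congr fun t => ?_
    split_ifs
    · exact hantiT t y
    · rw [neg_zero]
  have eR : ∀ y : Site (d + 1), (∑' t : Site (d + 1), (if t μ % ((Lc * N : ℕ) : ℤ) = ((Lc * N : ℕ) : ℤ) - 1 then
          unitS sf sm (fun κ t => c₀ • e3OfK Lc (coDressKBmAt (toSite (ctrOff (d + 1) Lc)) Lc (KInvStep (d := d) Lc j)) M κ t) μ t y x (Sum.inl α) (Sum.inl a) else 0)) =
      -(∑' t : Site (d + 1), (if t μ % ((Lc * N : ℕ) : ℤ) = ((Lc * N : ℕ) : ℤ) - 1 then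
          unitS sf sm (fun κ t => c₀ • e3OfK Lc (coDressKBmAt (toSite (ctrOff (d + 1) Lc)) Lc (KInvStep (d := d) Lc j)) M κ t) μ t x y (Sum.inl a) (Sum.inl α) else 0)) := by
    intro y
    rw [← tsum_neg]
    refine tsum_congr fun t => ?_
    split_ifs
    · exact hanti μ t x y (Sum.inl a) (Sum.inl α)
    · rw [neg_zero]
  simp_rw [eL, eR, mul_neg, tsum_neg]
  rw [faceCurrent_transport_sector_eq sf sm c₀ j N hM hδM μ α hdiv a x]

end Sector

/-! ## §3 The (D) letter of the comb E-sector at the period `Lc·N`, in g87 L's currency -/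

/-- NOT IN PRINT; OUR BOOKKEEPING ([folklore]).  **(D)_comb IN g87 L's CURRENCY AT PERIOD `Lc·N`**: the period-`Lc·N` exit-face two-leg current of `S^E_j = unitS (c₀ • e3OfK Lc G_j (𝒯 S̃comb_j))` is
first-leg divergence-free (g87 K `divFree_e3OfK_transport_ScombOf` with the class datum `(Lc·N)⁻¹ + dΦ`, `Φ(n) = −(Lc·N)⁻¹·(n mod Lc·N)` — leaf-04's `face_eq_class` at the period `Lc·N`). -/
theorem divFree_sector_comb (cΛt sf sm c₀ cE cVH cΛ : ℝ) (j N : ℕ) [NeZero N] (ν β : Fin (d + 1)) (x : Site (d + 1)) :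
    ∑ κ : Fin (d + 1),
      ((∑' q : Site (d + 1), (if q β % ((Lc * N : ℕ) : ℤ) = ((Lc * N : ℕ) : ℤ) - 1 then (1 : ℝ) else 0) *
          ∑' u : Site (d + 1), (if u ν % ((Lc * N : ℕ) : ℤ) = ((Lc * N : ℕ) : ℤ) - 1 then (1 : ℝ) else 0) *
            unitS sf sm (fun κ t => c₀ • e3OfK Lc (coDressKBmAt (toSite (ctrOff (d + 1) Lc)) Lc (KInvStep (d := d) Lc j))
              (fun κ u => comp (comp (trK (psiKS (ctrOff (d + 1) Lc) Lc)) (slotPsiS (ctrOff (d + 1) Lc) Lc (ScombOf (symTablesAn1S2 d Lc cΛt) cE cVH cΛ j) κ u)) (psiKS (ctrOff (d + 1) Lc) Lc)) κ t)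
              ν u (x - unitVec κ) q (Sum.inl κ) (Sum.inl β))
        - ∑' q : Site (d + 1), (if q β % ((Lc * N : ℕ) : ℤ) = ((Lc * N : ℕ) : ℤ) - 1 then (1 : ℝ) else 0) *
          ∑' u : Site (d + 1), (if u ν % ((Lc * N : ℕ) : ℤ) = ((Lc * N : ℕ) : ℤ) - 1 then (1 : ℝ) else 0) *
            unitS sf sm (fun κ t => c₀ • e3OfK Lc (coDressKBmAt (toSite (ctrOff (d + 1) Lc)) Lc (KInvStep (d := d) Lc j))
              (fun κ u => comp (comp (trK (psiKS (ctrOff (d + 1) Lc) Lc)) (slotPsiS (ctrOff (d + 1) Lc) Lc (ScombOf (symTablesAn1S2 d Lc cΛt) cE cVH cΛ j) κ u)) (psiKS (ctrOff (d + 1) Lc) Lc)) κ t)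
              ν u x q (Sum.inl κ) (Sum.inl β)) = 0 := by
  haveI : NeZero (Lc * N) := ⟨Nat.mul_ne_zero (NeZero.ne Lc) (NeZero.ne N)⟩
  -- the face indicator as the class datum at period `Lc·N`
  have hcls : ∀ n : ℤ, (if n % ((Lc * N : ℕ) : ℤ) = ((Lc * N : ℕ) : ℤ) - 1 then (1 : ℝ) else 0) =
      (((Lc * N : ℕ) : ℝ))⁻¹ + ((-((((Lc * N : ℕ) : ℝ))⁻¹) * ((((n + 1) % ((Lc * N : ℕ) : ℤ) : ℤ) : ℝ))) - (-((((Lc * N : ℕ) : ℝ))⁻¹) * (((n % ((Lc * N : ℕ) : ℤ) : ℤ) : ℝ)))) :=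
    fun n => (face_eq_class (Lc := Lc * N) n).symm
  have key := divFree_e3OfK_transport_ScombOf (d := d) (Lc := Lc) cΛt cE cVH cΛ j ν β ((((Lc * N : ℕ) : ℝ))⁻¹)
    (fun n : ℤ => -((((Lc * N : ℕ) : ℝ))⁻¹) * (((n % ((Lc * N : ℕ) : ℤ) : ℤ) : ℝ))) (fun n => abs_facePot_le (Lc := Lc * N) n) ((((Lc * N : ℕ) : ℝ))⁻¹)
    (fun n : ℤ => -((((Lc * N : ℕ) : ℝ))⁻¹) * (((n % ((Lc * N : ℕ) : ℤ) : ℤ) : ℝ))) (fun n => abs_facePot_le (Lc := Lc * N) n) x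
  simp only [← hcls, b6unitVec_eq, show (ctr (d + 1) Lc : Site (d + 1)) = toSite (ctrOff (d + 1) Lc) from rfl] at key
  -- units and amplitude are one constant
  have hin : ∀ (y q : Site (d + 1)) (κ : Fin (d + 1)),
      (∑' u : Site (d + 1), (if u ν % ((Lc * N : ℕ) : ℤ) = ((Lc * N : ℕ) : ℤ) - 1 then (1 : ℝ) else 0) *
        unitS sf sm (fun κ t => c₀ • e3OfK Lc (coDressKBmAt (toSite (ctrOff (d + 1) Lc)) Lc (KInvStep (d := d) Lc j))
          (fun κ u => comp (comp (trK (psiKS (ctrOff (d + 1) Lc) Lc)) (slotPsiS (ctrOff (d + 1) Lc) Lc (ScombOf (symTablesAn1S2 d Lc cΛt) cE cVH cΛ j) κ u)) (psiKS (ctrOff (d + 1) Lc) Lc)) κ t)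
          ν u y q (Sum.inl κ) (Sum.inl β)) =
      ((sf * sm)⁻¹ * (sf⁻¹ * sf⁻¹ * c₀)) * ∑' u : Site (d + 1), (if u ν % ((Lc * N : ℕ) : ℤ) = ((Lc * N : ℕ) : ℤ) - 1 then (1 : ℝ) else 0) *
        e3OfK Lc (coDressKBmAt (toSite (ctrOff (d + 1) Lc)) Lc (KInvStep (d := d) Lc j))
          (fun κ u => comp (comp (trK (psiKS (ctrOff (d + 1) Lc) Lc)) (slotPsiS (ctrOff (d + 1) Lc) Lc (ScombOf (symTablesAn1S2 d Lc cΛt) cE cVH cΛ j) κ u)) (psiKS (ctrOff (d + 1) Lc) Lc))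
          ν u y q (Sum.inl κ) (Sum.inl β) := by
    intro y q κ
    rw [← tsum_mul_left]
    refine tsum_congr fun u => ?_
    rw [unitS_smul_inl_inl]
    ring
  have hout : ∀ (y : Site (d + 1)) (κ : Fin (d + 1)),
      (∑' q : Site (d + 1), (if q β % ((Lc * N : ℕ) : ℤ) = ((Lc * N : ℕ) : ℤ) - 1 then (1 : ℝ) else 0) *
        ∑' u : Site (d + 1), (if u ν % ((Lc * N : ℕ) : ℤ) = ((Lc * N : ℕ) : ℤ) - 1 then (1 : ℝ) else 0) *
          unitS sf sm (fun κ t => c₀ • e3OfK Lc (coDressKBmAt (toSite (ctrOff (d + 1) Lc)) Lc (KInvStep (d := d) Lc j))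
            (fun κ u => comp (comp (trK (psiKS (ctrOff (d + 1) Lc) Lc)) (slotPsiS (ctrOff (d + 1) Lc) Lc (ScombOf (symTablesAn1S2 d Lc cΛt) cE cVH cΛ j) κ u)) (psiKS (ctrOff (d + 1) Lc) Lc)) κ t)
            ν u y q (Sum.inl κ) (Sum.inl β)) =
      ((sf * sm)⁻¹ * (sf⁻¹ * sf⁻¹ * c₀)) * ∑' q : Site (d + 1), (if q β % ((Lc * N : ℕ) : ℤ) = ((Lc * N : ℕ) : ℤ) - 1 then (1 : ℝ) else 0) *
        ∑' u : Site (d + 1), (if u ν % ((Lc * N : ℕ) : ℤ) = ((Lc * N : ℕ) : ℤ) - 1 then (1 : ℝ) else 0) *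
          e3OfK Lc (coDressKBmAt (toSite (ctrOff (d + 1) Lc)) Lc (KInvStep (d := d) Lc j))
            (fun κ u => comp (comp (trK (psiKS (ctrOff (d + 1) Lc) Lc)) (slotPsiS (ctrOff (d + 1) Lc) Lc (ScombOf (symTablesAn1S2 d Lc cΛt) cE cVH cΛ j) κ u)) (psiKS (ctrOff (d + 1) Lc) Lc))
            ν u y q (Sum.inl κ) (Sum.inl β) := by
    intro y κ
    simp_rw [hin]
    rw [← tsum_mul_left]
    exact tsum_congr fun q => by ring
  simp_rw [hout, ← mul_sub, ← Finset.mul_sum]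
  refine mul_eq_zero_of_right _ ?_
  rw [← neg_eq_zero, ← Finset.sum_neg_distrib]
  simpa only [neg_sub] using key

end Summit.QuantumFields.BalabanUV.Beta.GAN24.CombFaceWordSockets

end
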